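import Mathlib
import HarnessLib
import Summits.HubbardSuperconductivity.HubbardSuperconductivity.Theorems.KLProgrammeH10TwoPointLimitKlAnisoOffUmklappCount
import Summits.HubbardSuperconductivity.HubbardSuperconductivity.Theorems.KLProgrammeKLRegimeSplitOnWindow

/-!
# Route `KLProgramme` — K3 engine child `KLRegimeEngineV17F2` (stmt-HubbardSuperconductivity-20437), stub (b) `(Hμ)` re-sectorisation:
# «KEYED-R1-OFFCLASS» AT ALL SCALES — the umklapp splitter and the keyed off-class relative count WITHOUT the scale threshold `k₀`

Cell gate-hubbard-kl, seat p4 (C5a), g12.  The landed rows `sum_signedReps_eq_zero_of_offUmklapp_frame` (g11) and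
`card_relCount_prescribed_offUmklapp_klAniso_le_frame` (g12) hold for scales `k₀ ≤ k ≤ J′`, `k₀` an opaque threshold coming from fitting the shell
`Λ_k = klE0·4^{−k}` into the band window `((μ₁−4)/2, μ₂/2)` chosen there.  The jump lemmas of k3c2-p3 quantify over ALL `k ≤ J′`.  On the level windows
of «KEYED-R1-OFFCLASS» (`-4 < μ₁ − 4·klE0`, `μ₂ + 4·klE0 < 0`, e.g. `klWindowC`) the band constants can be taken on `[μ₁ − 4klE0, μ₂ + 4klE0]`, where the
shell of EVERY scale fits (`Λ_k ≤ klE0`), so the threshold disappears: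

* `sum_signedReps_eq_zero_of_offUmklapp_frame_allScales` — the splitter for all `0 ≤ k ≤ J′` (verbatim g11's argument on the enlarged window);
* `card_relCount_prescribed_offUmklapp_klAniso_le_frame_allScales` — the keyed off-class count for all `0 ≤ k ≤ J′` (verbatim the g12 assembly);
* `…_le_frameOK_allScales`, `…_le_window_allScales` — in the stub-(b) binders (`C, D` before `R`; `μ ∈ klWindowC`).

Everything is PROVED; no definitions, no named facts.  References: BGM 2006 §2.7–§2.8 (2.66)–(2.73), App. A3 Lemma A3.1 [cite: BenfattoGiulianiMastropietro2006];
BGM 2003 §3.1 Lemma 3.1 (4.3), §7.4 [cite: BenfattoGiulianiMastropietro2003].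
-/

noncomputable section

namespace Summit.HubbardSuperconductivity.HubbardSuperconductivity.Theorems.PerturbedFermiCurve

set_option linter.dupNamespace false -- summit = problem name (single-conjunct summit), D-0017

open Classical
open Real Set Finset
open Literature.MathematicalPhysics.QuantumLattice Literature.MathematicalPhysics.QuantumLattice.BandSectorCounting
open Literature.MathematicalPhysics.QuantumLattice.FermiRG Literature.MathematicalPhysics.QuantumLattice.FermiRG.BGM2003
open Literature.MathematicalPhysics.QuantumLattice.FermiRG.BGM2006AppA (signedMom_mem_sSector2003 sSector2003_subset_of_le)
open Literature.Probability.LatticeModels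
open Summit.HubbardSuperconductivity.HubbardSuperconductivity.Theorems.DispersionFlow
open Summit.HubbardSuperconductivity.HubbardSuperconductivity.Theorems.KLRegimeSplit
open Summit.HubbardSuperconductivity.HubbardSuperconductivity.Theorems.KLProgrammeLegKernels
open Summit.HubbardSuperconductivity.HubbardSuperconductivity.Theorems.TorusFourierL2

/-! ## §1 The splitter at all scales -/

/-- **OFF THE UMKLAPP-ACTIVE CLASS, EVERY ADMISSIBLE REFINEMENT CONSERVES MOMENTUM IN `ℝ²` — AT ALL SCALES `0 ≤ k ≤ J′`** (twin of g11's
`sum_signedReps_eq_zero_of_offUmklapp_frame` without the scale threshold, for level windows `[μ₁, μ₂]` with `-4 < μ₁ − 4·klE0`, `μ₂ + 4·klE0 < 0`: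
the band constants are taken on `[μ₁ − 4klE0, μ₂ + 4klE0]`, so the shell `Λ_k ≤ klE0` of every scale fits the level range).
[cite: BenfattoGiulianiMastropietro2006, §2.8 (2.73), App. A3] -/
theorem sum_signedReps_eq_zero_of_offUmklapp_frame_allScales :
    ∀ μ₁ μ₂ : ℝ, -4 < μ₁ - 4 * klE0 → μ₁ ≤ μ₂ → μ₂ + 4 * klE0 < 0 → ∃ κ : ℝ, 0 < κ ∧ ∃ C : ℝ, 0 < C ∧
      ∀ (K : TrigPolyC4v) (A : ℝ), (∀ p : Momentum, ∀ j ≤ 2, ‖iteratedFDeriv ℝ j (frameShift K) p‖ ≤ A) → 4 * A ≤ κ →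
      ∀ μ ∈ Set.Icc μ₁ μ₂, ∀ (L M : ℕ) [NeZero L] (β : ℝ) (m k J' : ℕ), k ≤ J' →
      ∀ (σ' : Fin (m + 1) → SectorLeg (sectorCount k)) (σ'' : Fin (m + 1) → SectorLeg (sectorCount J')),
      (∀ i, (∃ q : FreqMomentum L M, klAnisoFamily L M β μ K klE0 J' (σ'' i).1.1 q ≠ 0 ∧
          bgmFatMultiplier L M klE0 β (nambuXiCT L μ K) k (σ' i).1.1 q ≠ 0) ∧ (σ' i).1.2 = (σ'' i).1.2 ∧ (σ' i).2 = (σ'' i).2) →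
      (∀ G : Fin 2 → ℤ, G ≠ 0 → ∃ j : Fin 2, ((m : ℝ) + 1) * C * sectorWidth k <
          |∑ i, (if (σ' i).2 = 0 then klFermiPoint μ K (sectorCenter k (σ' i).1.1) j
              else -klFermiPoint μ K (sectorCenter k (σ' i).1.1) j) - 2 * π * (G j : ℝ)|) →
      ∀ kf : Fin (m + 1) → FreqMomentum L M, (∀ i, klAnisoFamily L M β μ K klE0 J' (σ'' i).1.1 (kf i) ≠ 0) →
        ∑ i, signedMomentum L (σ'' i).2 (kf i).2 = 0 →
        ∀ j : Fin 2, ∑ i, (if (σ'' i).2 = 0 then torusCentredMomentum L (kf i).2 j else -torusCentredMomentum L (kf i).2 j) = 0 := by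
  intro μ₁ μ₂ hμ₁ h12 hμ₂
  have he : (0 : ℝ) < klE0 := by norm_num [klE0]
  have hab : μ₁ - 4 * klE0 ≤ μ₂ + 4 * klE0 := by linarith
  obtain ⟨B, -⟩ : ∃ B : BandBounds (μ₁ - 4 * klE0) (μ₂ + 4 * klE0), B = bandBounds hμ₁ hab hμ₂ := ⟨_, rfl⟩
  have hDt := B.Dtmin_pos; have hs := B.smax_pos; have hπ := Real.pi_pos
  obtain ⟨C, hC⟩ : ∃ C : ℝ, C = 2 * (klE0 / π + B.smax * B.Dtmin * (13 / 4)) / B.Dtmin := ⟨_, rfl⟩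
  have hC0 : 0 < C := by rw [hC]; positivity
  refine ⟨min (B.Dtmin / 2) klE0, lt_min (by positivity) he, C, hC0, ?_⟩
  intro K A hA hAκ μ hμ L M _ β m k J' hkJ σ' σ'' hover hoff kf hkF hsum j
  have hA0 : 0 ≤ A := le_trans (norm_nonneg _) (hA 0 0 (by norm_num))
  have hκD : 4 * A ≤ B.Dtmin / 2 := hAκ.trans (min_le_left _ _)
  have hκm : 4 * A ≤ klE0 := hAκ.trans (min_le_right _ _)
  have hA2 : 2 * A < B.Dtmin := by linarith
  -- the shell of every scale fits: `Λ_k ≤ Λ_0 = klE0`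
  have hΛ : klScale klE0 k ≤ klE0 := (klld_klScale_anti (Nat.zero_le k)).trans (by simp [klScale])
  have hlo : μ₁ - 4 * klE0 ≤ μ - A - klScale klE0 k := by linarith [hμ.1]
  have hhi : μ + A + klScale klE0 k ≤ μ₂ + 4 * klE0 := by linarith [hμ.2]
  have hwk : 0 < sectorWidth k := sectorWidth_pos k
  have hwπ : sectorWidth k ≤ π := sectorWidth_le_pi k
  -- the cell radius at the coarse centre is `≤ C·w_k`
  have hden : B.Dtmin / 2 ≤ B.Dtmin - 2 * A := by linarith
  have hrad : (klScale klE0 k + B.smax * B.Dtmin * (13 / 4 * sectorWidth k)) / (B.Dtmin - 2 * A) ≤ C * sectorWidth k := by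
    have hkl : klScale klE0 k ≤ klE0 / π * sectorWidth k := by
      rw [klScale_eq_mul_sectorWidth_sq, div_mul_eq_mul_div, div_mul_eq_mul_div, div_le_div_iff₀ (by positivity) (by positivity)]
      calc klE0 * sectorWidth k ^ 2 * π = (klE0 * sectorWidth k * π) * sectorWidth k := by ring
        _ ≤ (klE0 * sectorWidth k * π) * π := mul_le_mul_of_nonneg_left hwπ (by positivity)
        _ = klE0 * sectorWidth k * π ^ 2 := by ring
    have hnum : klScale klE0 k + B.smax * B.Dtmin * (13 / 4 * sectorWidth k) ≤ (klE0 / π + B.smax * B.Dtmin * (13 / 4)) * sectorWidth k := by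
      rw [add_mul]; linarith
    have h1 : (klScale klE0 k + B.smax * B.Dtmin * (13 / 4 * sectorWidth k)) / (B.Dtmin - 2 * A) ≤
        (klE0 / π + B.smax * B.Dtmin * (13 / 4)) * sectorWidth k / (B.Dtmin / 2) :=
      div_le_div₀ (by positivity) hnum (by positivity) hden
    have e : (klE0 / π + B.smax * B.Dtmin * (13 / 4)) * sectorWidth k / (B.Dtmin / 2) = C * sectorWidth k := by
      rw [hC, div_eq_iff (by positivity)]
      field_simp
    linarith [h1, e]
  -- every signed representative is within `C·w_k` of the signed coarse Fermi point
  have hleg : ∀ i, |(if (σ'' i).2 = 0 then torusCentredMomentum L (kf i).2 j else -torusCentredMomentum L (kf i).2 j) -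
      (if (σ' i).2 = 0 then klFermiPoint μ K (sectorCenter k (σ' i).1.1) j else -klFermiPoint μ K (sectorCenter k (σ' i).1.1) j)| ≤
        C * sectorWidth k := by
    intro i
    obtain ⟨⟨q₀, hq₀, hq₀'⟩, -, hc⟩ := hover i
    have h := (abs_rep_sub_fermiPoint_le_of_overlap B hA hA2 L M hkJ hlo hhi (hkF i) hq₀ hq₀' j).trans hrad
    rw [← hc]
    split_ifs
    · exact h
    · have e : -torusCentredMomentum L (kf i).2 j - -klFermiPoint μ K (sectorCenter k (σ' i).1.1) j =
          -(torusCentredMomentum L (kf i).2 j - klFermiPoint μ K (sectorCenter k (σ' i).1.1) j) := by ring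
      rw [e, abs_neg]; exact h
  -- the reciprocal vector
  obtain ⟨G, hG⟩ := exists_sum_signed_torusCentredMomentum_eq L (fun i => (σ'' i).2) (fun i => (kf i).2) hsum
  by_cases hG0 : G = 0
  · rw [hG j, hG0]; simp
  · exfalso
    obtain ⟨j', hj'⟩ := hoff G hG0
    have hclose : |∑ i, (if (σ' i).2 = 0 then klFermiPoint μ K (sectorCenter k (σ' i).1.1) j'
        else -klFermiPoint μ K (sectorCenter k (σ' i).1.1) j') - 2 * π * (G j' : ℝ)| ≤ ((m : ℝ) + 1) * C * sectorWidth k := by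
      rw [← hG j', ← Finset.sum_sub_distrib]
      refine (Finset.abs_sum_le_sum_abs _ _).trans ?_
      have hleg' : ∀ i, |(if (σ' i).2 = 0 then klFermiPoint μ K (sectorCenter k (σ' i).1.1) j'
          else -klFermiPoint μ K (sectorCenter k (σ' i).1.1) j') -
          (if (σ'' i).2 = 0 then torusCentredMomentum L (kf i).2 j' else -torusCentredMomentum L (kf i).2 j')| ≤ C * sectorWidth k := by
        intro i
        rw [abs_sub_comm]
        obtain ⟨⟨q₀, hq₀, hq₀'⟩, -, hc⟩ := hover i
        have h := (abs_rep_sub_fermiPoint_le_of_overlap B hA hA2 L M hkJ hlo hhi (hkF i) hq₀ hq₀' j').trans hrad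
        rw [← hc]
        split_ifs
        · exact h
        · have e : -torusCentredMomentum L (kf i).2 j' - -klFermiPoint μ K (sectorCenter k (σ' i).1.1) j' =
              -(torusCentredMomentum L (kf i).2 j' - klFermiPoint μ K (sectorCenter k (σ' i).1.1) j') := by ring
          rw [e, abs_neg]; exact h
      calc ∑ i, |(if (σ' i).2 = 0 then klFermiPoint μ K (sectorCenter k (σ' i).1.1) j'
            else -klFermiPoint μ K (sectorCenter k (σ' i).1.1) j') -
            (if (σ'' i).2 = 0 then torusCentredMomentum L (kf i).2 j' else -torusCentredMomentum L (kf i).2 j')|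
          ≤ ∑ _i : Fin (m + 1), C * sectorWidth k := Finset.sum_le_sum fun i _ => hleg' i
        _ = ((m : ℝ) + 1) * C * sectorWidth k := by simp; ring
    linarith

/-! ## §2 The keyed off-class relative count at all scales -/

/-- **The keyed OFF-CLASS relative count, exponent `(m+1) − 3`, ALL SCALES `0 ≤ k ≤ J′`** (twin of `card_relCount_prescribed_offUmklapp_klAniso_le_frame`
without the scale threshold). [cite: BenfattoGiulianiMastropietro2006, App. A3 Lemma A3.1; BenfattoGiulianiMastropietro2003, §3.1 Lemma 3.1 (4.3)] -/
theorem card_relCount_prescribed_offUmklapp_klAniso_le_frame_allScales :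
    ∀ μ₁ μ₂ : ℝ, -4 < μ₁ - 4 * klE0 → μ₁ ≤ μ₂ → μ₂ + 4 * klE0 < 0 →
      ∃ κ : ℝ, 0 < κ ∧ ∃ C : ℝ, 0 < C ∧ ∃ D : ℝ, 0 < D ∧
      ∀ (K : TrigPolyC4v) (A : ℝ), (∀ p : Momentum, ∀ j ≤ 2, ‖iteratedFDeriv ℝ j (frameShift K) p‖ ≤ A) → 4 * A ≤ κ →
      ∀ μ ∈ Set.Icc μ₁ μ₂, ∀ (L M : ℕ) [NeZero L] (β : ℝ) (m k J' : ℕ), k ≤ J' → 3 ≤ m →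
      ∀ (A'' : Finset (Fin (m + 1) → SectorLeg (sectorCount J'))),
        A'' ⊆ bgmSectorSet L M (klAnisoFamily L M β μ K klE0 J') (m + 1) →
      ∀ (E : Finset (Fin (m + 1))) (τ'' : Fin (m + 1) → SectorLeg (sectorCount J')) (p : Fin (m + 1)), p ∈ E →
      ∀ σ' : Fin (m + 1) → SectorLeg (sectorCount k),
      (∀ G : Fin 2 → ℤ, G ≠ 0 → ∃ j : Fin 2, ((m : ℝ) + 1) * C * sectorWidth k <
          |∑ i, (if (σ' i).2 = 0 then klFermiPoint μ K (sectorCenter k (σ' i).1.1) j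
              else -klFermiPoint μ K (sectorCenter k (σ' i).1.1) j) - 2 * π * (G j : ℝ)|) →
      ((((A''.filter fun σ'' => (∀ e ∈ E, σ'' e = τ'' e) ∧ ∀ i,
          (∃ q : FreqMomentum L M, klAnisoFamily L M β μ K klE0 J' (σ'' i).1.1 q ≠ 0 ∧
            bgmFatMultiplier L M klE0 β (nambuXiCT L μ K) k (σ' i).1.1 q ≠ 0) ∧
          (σ' i).1.2 = (σ'' i).1.2 ∧ (σ' i).2 = (σ'' i).2).card : ℕ) : ℝ)) ≤
        D ^ (m + 1) * (2 : ℝ) ^ ((J' - k) * ((m + 1) - 3)) := by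
  intro μ₁ μ₂ hμ₁ h12 hμ₂
  have he0 : (0 : ℝ) < klE0 := by norm_num [klE0]
  -- the band constants on the enlarged window (for the support-to-chart dictionary)
  have hab : μ₁ - 4 * klE0 ≤ μ₂ + 4 * klE0 := by linarith
  obtain ⟨B, -⟩ : ∃ B : BandBounds (μ₁ - 4 * klE0) (μ₂ + 4 * klE0), B = bandBounds hμ₁ hab hμ₂ := ⟨_, rfl⟩
  have hDt := B.Dtmin_pos
  -- the splitter and the frame-uniform Lemma 3.1 with shell `klE0`
  obtain ⟨κs, hκs, C, hC, hsplit⟩ := sum_signedReps_eq_zero_of_offUmklapp_frame_allScales μ₁ μ₂ hμ₁ h12 hμ₂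
  obtain ⟨κc, hκc, c', hc', hcount⟩ := frame_bgm2003_sectorCounting_uniform_shell μ₁ μ₂ klE0 he0 hμ₁ h12 hμ₂
  obtain ⟨κ, hκdef⟩ : ∃ κ : ℝ, κ = min κs (min κc (min B.Dtmin klE0)) := ⟨_, rfl⟩
  have hκ0 : 0 < κ := by rw [hκdef]; exact lt_min hκs (lt_min hκc (lt_min hDt he0))
  have hκ1 : κ ≤ κs := by rw [hκdef]; exact min_le_left _ _
  have hκ2 : κ ≤ κc := by rw [hκdef]; exact (min_le_right _ _).trans (min_le_left _ _)
  have hκ3 : κ ≤ B.Dtmin := by rw [hκdef]; exact (min_le_right _ _).trans ((min_le_right _ _).trans (min_le_left _ _))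
  have hκ4 : κ ≤ klE0 := by rw [hκdef]; exact (min_le_right _ _).trans ((min_le_right _ _).trans (min_le_right _ _))
  refine ⟨κ, hκ0, C, hC, 5 * c', by positivity, ?_⟩
  intro K A hA hAκ μ hμ L M _ β m k J' hkJ hm A'' hA'' E τ'' p hp σ' hoff
  have hA0 : 0 ≤ A := le_trans (norm_nonneg _) (hA 0 0 (by norm_num))
  have hADt : 2 * A < B.Dtmin := by linarith
  have hlo : μ₁ - 4 * klE0 ≤ μ - A - klE0 := by linarith [hμ.1]
  have hhi : μ + A + klE0 ≤ μ₂ + 4 * klE0 := by linarith [hμ.2]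
  have hNpos : 0 < sectorCount k := sectorCount_pos k
  -- notation
  set u : ℝ → ℝ → ℝ := fun ϑ e => perturbedFermiRadius (fun q : Fin 2 → ℝ => frameShift K (WithLp.toLp 2 q)) (μ + e) ϑ with hu
  have hanti : ∀ θ e : ℝ, |e| ≤ klE0 → u (θ + π) e = u θ e := fun θ e _ =>
    perturbedFermiRadius_add_pi (frameShift_toLp_neg K) (μ + e) θ
  set S := A''.filter fun σ'' => (∀ e ∈ E, σ'' e = τ'' e) ∧ ∀ i,
      (∃ q : FreqMomentum L M, klAnisoFamily L M β μ K klE0 J' (σ'' i).1.1 q ≠ 0 ∧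
        bgmFatMultiplier L M klE0 β (nambuXiCT L μ K) k (σ' i).1.1 q ≠ 0) ∧
      (σ' i).1.2 = (σ'' i).1.2 ∧ (σ' i).2 = (σ'' i).2 with hSdef
  -- the half-turn index map and the signed fine string of a label tuple
  set hti : ℕ → Bool → ℕ → ℕ := fun n s j => if s then j else if j < 2 ^ n then j + 2 ^ n else j - 2 ^ n with hhti
  have hti_lt : ∀ (n : ℕ) (s : Bool) {j : ℕ}, j < sectorCount n → hti n s j < sectorCount n :=
    fun n s j hj => halfTurnIdx_lt s hj
  set Φ : (Fin (m + 1) → SectorLeg (sectorCount J')) → (Fin (m + 1) → Fin (sectorCount J')) :=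
    fun σ'' i => ⟨hti J' (decide ((σ'' i).2 = 0)) (σ'' i).1.1, hti_lt J' _ (σ'' i).1.1.isLt⟩ with hΦ
  -- the fixed fine index (leg `p`, prescribed) and the ancestor string map
  set ω₁ : ℕ := hti J' (decide ((τ'' p).2 = 0)) (τ'' p).1.1 with hω₁
  have hω₁lt : ω₁ < sectorCount J' := hti_lt J' _ (τ'' p).1.1.isLt
  set f : (Fin (m + 1) → SectorLeg (sectorCount J')) → (Fin (m + 1) → Fin (sectorCount k)) :=
    fun σ'' i => ⟨((Φ σ'' i : Fin (sectorCount J')) : ℕ) / 2 ^ (J' - k), div_pow_lt_sectorCount hkJ (Φ σ'' i).isLt⟩ with hf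
  -- the candidate coarse strings: `≤ 5` ancestors per leg
  set T : (Fin (m + 1) → Fin 5) → (Fin (m + 1) → Fin (sectorCount k)) := fun dv i =>
    ⟨hti k (decide ((σ' i).2 = 0))
        ((((((σ' i).1.1 : ℕ) : ℤ) + ((dv i : ℕ) : ℤ) - 2) % (sectorCount k : ℤ)).toNat),
      hti_lt k _ (toNat_emod_lt hNpos _)⟩ with hT
  -- (1) COVER: the ancestor string of every `σ″ ∈ S` is a candidate
  have hcover : ∀ σ'' ∈ S, f σ'' ∈ (univ : Finset (Fin (m + 1) → Fin 5)).image T := by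
    intro σ'' hσ''
    rw [hSdef, mem_filter] at hσ''
    obtain ⟨-, -, hleg⟩ := hσ''
    have hD : ∀ i, ∃ D : ℤ, |D| ≤ 2 ∧ (sectorCount k : ℤ) ∣
        (((((σ'' i).1.1 : ℕ) / 2 ^ (J' - k) : ℕ) : ℤ) - (((σ' i).1.1 : ℕ) : ℤ) - D) := by
      intro i
      obtain ⟨⟨q, hq, hq'⟩, -, -⟩ := hleg i
      exact exists_ancestor_near_of_overlap L M he0 hkJ hq hq'
    choose Df hDf using hD
    refine mem_image.2 ⟨fun i => ⟨(Df i + 2).toNat, by have := (abs_le.1 (hDf i).1); omega⟩, mem_univ _, ?_⟩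
    funext i
    obtain ⟨hDabs, hDdvd⟩ := hDf i
    obtain ⟨-, hspin, hch⟩ := hleg i
    apply Fin.ext
    simp only [hT, hf, hΦ]
    have h2 : (((Df i + 2).toNat : ℕ) : ℤ) = Df i + 2 := by have := (abs_le.1 hDabs); omega
    rw [h2, show (((σ' i).1.1 : ℕ) : ℤ) + (Df i + 2) - 2 = (((σ' i).1.1 : ℕ) : ℤ) + Df i by ring]
    -- the ancestor IS the representative of `ω′ + D`
    have hanc : ((σ'' i).1.1 : ℕ) / 2 ^ (J' - k) = (((((σ' i).1.1 : ℕ) : ℤ) + Df i) % (sectorCount k : ℤ)).toNat :=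
      eq_toNat_emod_of_dvd hNpos (div_pow_lt_sectorCount hkJ (σ'' i).1.1.isLt) (by
        have e : ((((σ'' i).1.1 : ℕ) / 2 ^ (J' - k) : ℕ) : ℤ) - ((((σ' i).1.1 : ℕ) : ℤ) + Df i) =
            ((((σ'' i).1.1 : ℕ) / 2 ^ (J' - k) : ℕ) : ℤ) - (((σ' i).1.1 : ℕ) : ℤ) - Df i := by ring
        rw [e]; exact hDdvd)
    rw [← hanc, hch]
    simp only [hhti]
    exact (halfTurnIdx_div hkJ _ (σ'' i).1.1.isLt).symm
  -- (2) FIBRES: for a candidate coarse string `t`, the `σ″ ∈ S` with ancestor string `t` inject into BGM 2003's sector strings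
  have hfibre : ∀ t : Fin (m + 1) → Fin (sectorCount k),
      (((S.filter fun σ'' => f σ'' = t).card : ℕ) : ℝ) ≤
        Nat.card (sectorStrings u klE0 k J' (m + 1) p ω₁ (fun i => (t i : ℕ))) := by
    intro t
    set St := S.filter fun σ'' => f σ'' = t with hSt
    -- the map into the string set
    have hmem : ∀ σ'' ∈ St, Φ σ'' ∈ sectorStrings u klE0 k J' (m + 1) p ω₁ (fun i => (t i : ℕ)) := by
      intro σ'' hσ''
      rw [hSt, mem_filter, hSdef, mem_filter] at hσ''
      obtain ⟨⟨hAmem, hE, hleg⟩, hft⟩ := hσ''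
      refine ⟨?_, ?_, ?_⟩
      · -- the prescribed leg
        have := hE p hp
        show hti J' (decide ((σ'' p).2 = 0)) ((σ'' p).1.1 : ℕ) = ω₁
        rw [this]
      · -- nesting of the other legs in their ancestors
        intro i _
        have hti_eq : ((t i : Fin (sectorCount k)) : ℕ) = ((Φ σ'' i : Fin (sectorCount J')) : ℕ) / 2 ^ (J' - k) := by
          rw [← hft]
        have hsub := sSector2003_subset_of_le u he0.le hkJ ((Φ σ'' i : Fin (sectorCount J')) : ℕ)
        rw [← hti_eq] at hsub
        exact hsub
      · -- the momenta: supports → chart s-sectors, signs absorbed, conservation in `ℝ²` by the splitter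
        have hmemA := hA'' hAmem
        unfold bgmSectorSet at hmemA
        rw [mem_filter] at hmemA
        obtain ⟨-, kf, hkF, hsum⟩ := hmemA
        refine ⟨fun i => if decide ((σ'' i).2 = 0) then torusCentredMomentum L (kf i).2 else -torusCentredMomentum L (kf i).2,
          fun i => ?_, ?_⟩
        · have hrep := rep_mem_sSector2003_of_klAnisoFamily B hA hADt L M he0 β J' hlo hhi (hkF i)
          exact signedMom_mem_sSector2003 he0.le hanti (decide ((σ'' i).2 = 0)) hrep
        · have hz := hsplit K A hA (hAκ.trans hκ1) μ hμ L M β m k J' hkJ σ' σ'' hleg hoff kf hkF hsum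
          funext j
          rw [Finset.sum_apply]
          have e : ∀ i, (if decide ((σ'' i).2 = 0) then torusCentredMomentum L (kf i).2
              else -torusCentredMomentum L (kf i).2) j =
              (if (σ'' i).2 = 0 then torusCentredMomentum L (kf i).2 j else -torusCentredMomentum L (kf i).2 j) := by
            intro i
            by_cases h : (σ'' i).2 = 0
            · rw [decide_eq_true h, if_pos rfl, if_pos h]
            · rw [decide_eq_false h, if_neg Bool.false_ne_true, if_neg h, Pi.neg_apply]
          simp only [e]
          exact hz j
    -- injectivity on the fibre: spins and charges are those of `σ′`, the half-turn map is injective per charge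
    have hinj : Set.InjOn Φ (St : Set (Fin (m + 1) → SectorLeg (sectorCount J'))) := by
      intro a ha b hb hab
      rw [Finset.mem_coe, hSt, mem_filter, hSdef, mem_filter] at ha hb
      funext i
      obtain ⟨-, haspin, hach⟩ := ha.1.2.2 i
      obtain ⟨-, hbspin, hbch⟩ := hb.1.2.2 i
      have hi := congrArg (fun g => ((g i : Fin (sectorCount J')) : ℕ)) hab
      simp only [hΦ, hhti] at hi
      rw [← hach, ← hbch] at hi
      have hω : ((a i).1.1 : ℕ) = ((b i).1.1 : ℕ) := halfTurnIdx_injOn _ (a i).1.1.isLt (b i).1.1.isLt hi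
      exact Prod.ext (Prod.ext (Fin.ext hω) (haspin.symm.trans hbspin)) (hach.symm.trans hbch)
    -- count
    have hc : St.card ≤ Nat.card (sectorStrings u klE0 k J' (m + 1) p ω₁ (fun i => (t i : ℕ))) := by
      have h1 : Nat.card (St : Set (Fin (m + 1) → SectorLeg (sectorCount J'))) ≤
          Nat.card (sectorStrings u klE0 k J' (m + 1) p ω₁ (fun i => (t i : ℕ))) :=
        Nat.card_le_card_of_injective (fun x : (St : Set (Fin (m + 1) → SectorLeg (sectorCount J'))) =>
            (⟨Φ x.1, hmem x.1 x.2⟩ : sectorStrings u klE0 k J' (m + 1) p ω₁ (fun i => (t i : ℕ))))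
          (fun x y hxy => Subtype.ext (hinj x.2 y.2 (congrArg Subtype.val hxy)))
      rwa [Nat.card_coe_set_eq, Set.ncard_coe_finset] at h1
    exact_mod_cast hc
  -- (3) SUM OVER THE CANDIDATES
  have hcount' := (hcount K A hA (hAκ.trans hκ2) μ hμ k J' hkJ).1
  have hsum : ((S.card : ℕ) : ℝ) = ∑ t ∈ (univ : Finset (Fin (m + 1) → Fin 5)).image T,
      (((S.filter fun σ'' => f σ'' = t).card : ℕ) : ℝ) := by
    exact_mod_cast card_eq_sum_card_fiberwise hcover
  calc ((S.card : ℕ) : ℝ) = ∑ t ∈ (univ : Finset (Fin (m + 1) → Fin 5)).image T,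
        (((S.filter fun σ'' => f σ'' = t).card : ℕ) : ℝ) := hsum
    _ ≤ ∑ _t ∈ (univ : Finset (Fin (m + 1) → Fin 5)).image T, c' ^ (m + 1) * (2 : ℝ) ^ ((J' - k) * ((m + 1) - 3)) := by
        refine sum_le_sum fun t _ => (hfibre t).trans ?_
        exact hcount' (m + 1) p ω₁ (fun i => (t i : ℕ)) (by omega) hω₁lt (fun i => (t i).isLt)
    _ = (((univ : Finset (Fin (m + 1) → Fin 5)).image T).card : ℝ) * (c' ^ (m + 1) * (2 : ℝ) ^ ((J' - k) * ((m + 1) - 3))) := by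
        rw [sum_const, nsmul_eq_mul]
    _ ≤ (5 : ℝ) ^ (m + 1) * (c' ^ (m + 1) * (2 : ℝ) ^ ((J' - k) * ((m + 1) - 3))) := by
        refine mul_le_mul_of_nonneg_right ?_ (by positivity)
        have h1 : ((univ : Finset (Fin (m + 1) → Fin 5)).image T).card ≤ 5 ^ (m + 1) :=
          card_image_le.trans (by rw [card_univ, card_fun_fin_five])
        exact_mod_cast h1
    _ = (5 * c') ^ (m + 1) * (2 : ℝ) ^ ((J' - k) * ((m + 1) - 3)) := by rw [mul_pow]; ring


/-! ## §3 In the stub-(b) binders and on `klWindowC` -/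

/-- **The keyed off-class relative count ON EVERY ADMISSIBLE FRAME IN THE KL REGIME, all scales** (`C, D` before `R`).
[cite: BenfattoGiulianiMastropietro2006, App. A3 Lemma A3.1; BenfattoGiulianiMastropietro2003, §3.1 Lemma 3.1 (4.3)] -/
theorem card_relCount_prescribed_offUmklapp_klAniso_le_frameOK_allScales :
    ∀ μ₁ μ₂ : ℝ, -4 < μ₁ - 4 * klE0 → μ₁ ≤ μ₂ → μ₂ + 4 * klE0 < 0 →
      ∃ C : ℝ, 0 < C ∧ ∃ D : ℝ, 0 < D ∧ ∀ R : RenConsts, (∀ j, 0 ≤ R.Gfr j) →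
      ∃ c₃ : ℝ, 0 < c₃ ∧ ∃ U₀ : ℝ, 0 < U₀ ∧
      ∀ c : ℝ, 0 < c → c ≤ c₃ → ∀ U : ℝ, 0 < U → U ≤ U₀ → ∀ β : ℝ, klBetaMin ≤ β → β ≤ Real.exp (c / U ^ 2) →
      ∀ μ ∈ Set.Icc μ₁ μ₂, ∀ (ν : ℝ) (K : TrigPolyC4v), FrameOK R U (nScales β) ν K →
      ∀ (L M : ℕ) [NeZero L] (m k J' : ℕ), k ≤ J' → 3 ≤ m →
      ∀ (A'' : Finset (Fin (m + 1) → SectorLeg (sectorCount J'))),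
        A'' ⊆ bgmSectorSet L M (klAnisoFamily L M β μ K klE0 J') (m + 1) →
      ∀ (E : Finset (Fin (m + 1))) (τ'' : Fin (m + 1) → SectorLeg (sectorCount J')) (p : Fin (m + 1)), p ∈ E →
      ∀ σ' : Fin (m + 1) → SectorLeg (sectorCount k),
      (∀ G : Fin 2 → ℤ, G ≠ 0 → ∃ j : Fin 2, ((m : ℝ) + 1) * C * sectorWidth k <
          |∑ i, (if (σ' i).2 = 0 then klFermiPoint μ K (sectorCenter k (σ' i).1.1) j
              else -klFermiPoint μ K (sectorCenter k (σ' i).1.1) j) - 2 * π * (G j : ℝ)|) →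
      ((((A''.filter fun σ'' => (∀ e ∈ E, σ'' e = τ'' e) ∧ ∀ i,
          (∃ q : FreqMomentum L M, klAnisoFamily L M β μ K klE0 J' (σ'' i).1.1 q ≠ 0 ∧
            bgmFatMultiplier L M klE0 β (nambuXiCT L μ K) k (σ' i).1.1 q ≠ 0) ∧
          (σ' i).1.2 = (σ'' i).1.2 ∧ (σ' i).2 = (σ'' i).2).card : ℕ) : ℝ)) ≤
        D ^ (m + 1) * (2 : ℝ) ^ ((J' - k) * ((m + 1) - 3)) := by
  intro μ₁ μ₂ hμ₁ h12 hμ₂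
  obtain ⟨κ, hκ, C, hC, D, hD, h⟩ := card_relCount_prescribed_offUmklapp_klAniso_le_frame_allScales μ₁ μ₂ hμ₁ h12 hμ₂
  refine ⟨C, hC, D, hD, fun R hR => ?_⟩
  obtain ⟨c₃, hc₃, U₀, hU₀, hthr⟩ := frame_thresholds hR hκ
  refine ⟨c₃, hc₃, U₀, hU₀, ?_⟩
  intro c hc hcle U hU hUle β hβmin hβc μ hμ ν K hK L M _ m k J' hkJ hm A'' hA'' E τ'' p hp σ' hoff
  exact h K _ (fun q j hj => norm_iteratedFDeriv_frameShift_le_of_frameOK_regime hR hc.le hβmin hβc hK q hj)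
    (hthr c U hc.le hcle hU hUle) μ hμ L M β m k J' hkJ hm A'' hA'' E τ'' p hp σ' hoff

/-- **The keyed off-class relative count on `klWindowC`, all scales `0 ≤ k ≤ J′`** — the `hRoff`/`A₁` row for k3c2-p3's split bricks with B := the
umklapp-active class. [cite: BenfattoGiulianiMastropietro2006, App. A3 Lemma A3.1; BenfattoGiulianiMastropietro2003, §3.1 Lemma 3.1 (4.3)] -/
theorem card_relCount_prescribed_offUmklapp_klAniso_le_window_allScales :
    ∃ C : ℝ, 0 < C ∧ ∃ D : ℝ, 0 < D ∧ ∀ R : RenConsts, (∀ j, 0 ≤ R.Gfr j) →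
      ∃ c₃ : ℝ, 0 < c₃ ∧ ∃ U₀ : ℝ, 0 < U₀ ∧
      ∀ c : ℝ, 0 < c → c ≤ c₃ → ∀ U : ℝ, 0 < U → U ≤ U₀ → ∀ β : ℝ, klBetaMin ≤ β → β ≤ Real.exp (c / U ^ 2) →
      ∀ μ ∈ klWindowC, ∀ (ν : ℝ) (K : TrigPolyC4v), FrameOK R U (nScales β) ν K →
      ∀ (L M : ℕ) [NeZero L] (m k J' : ℕ), k ≤ J' → 3 ≤ m →
      ∀ (A'' : Finset (Fin (m + 1) → SectorLeg (sectorCount J'))),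
        A'' ⊆ bgmSectorSet L M (klAnisoFamily L M β μ K klE0 J') (m + 1) →
      ∀ (E : Finset (Fin (m + 1))) (τ'' : Fin (m + 1) → SectorLeg (sectorCount J')) (p : Fin (m + 1)), p ∈ E →
      ∀ σ' : Fin (m + 1) → SectorLeg (sectorCount k),
      (∀ G : Fin 2 → ℤ, G ≠ 0 → ∃ j : Fin 2, ((m : ℝ) + 1) * C * sectorWidth k <
          |∑ i, (if (σ' i).2 = 0 then klFermiPoint μ K (sectorCenter k (σ' i).1.1) j
              else -klFermiPoint μ K (sectorCenter k (σ' i).1.1) j) - 2 * π * (G j : ℝ)|) →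
      ((((A''.filter fun σ'' => (∀ e ∈ E, σ'' e = τ'' e) ∧ ∀ i,
          (∃ q : FreqMomentum L M, klAnisoFamily L M β μ K klE0 J' (σ'' i).1.1 q ≠ 0 ∧
            bgmFatMultiplier L M klE0 β (nambuXiCT L μ K) k (σ' i).1.1 q ≠ 0) ∧
          (σ' i).1.2 = (σ'' i).1.2 ∧ (σ' i).2 = (σ'' i).2).card : ℕ) : ℝ)) ≤
        D ^ (m + 1) * (2 : ℝ) ^ ((J' - k) * ((m + 1) - 3)) :=
  card_relCount_prescribed_offUmklapp_klAniso_le_frameOK_allScales (-1.05) (-0.15) (by norm_num [klE0]) (by norm_num) (by norm_num [klE0])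

end Summit.HubbardSuperconductivity.HubbardSuperconductivity.Theorems.PerturbedFermiCurve

end
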